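import Mathlib
import HarnessLib
import Summits.Ventures.LatticeQCDFlow.Exactness.SphereLOFlowAction
import Summits.Ventures.LatticeQCDFlow.Exactness.SphereSiteLaplacianCalculus

/-!
# The three lattice polynomials of the next order: staple, cross and square terms of `Σ_n ‖p_n‖²`, and the lattice Laplace–Beltrami operator on each (eigenvalues `2(d−1)`, `4d−2`, `4d` up to explicit lower-order terms)

HONEST FRAMING: exact (Metropolis-corrected) sampling algorithms for lattice gauge theory;
figures of merit are autocorrelation/cost numbers at stated couplings and volumes; no
continuum-physics claim.

Venture `LatticeQCDFlow` (cell pub-lqcd), topic `Exactness`; FANOUT row 7 (`s0-cpn-null`: the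
S0-D1 rung — 2D CP⁹, Lüscher's LO trivializing map inside HMC, Engel–Schaefer 2011).  NEW WORK of
the cell (this order is NOT in Engel–Schaefer, who implement the leading order only: "the leading
order term can be constructed easily") over the tree's `SphereLOFlowAction.lean` (couplings `U`
with no self-coupling and adjoint pairs, `localField`) and `SphereSiteLaplacianCalculus.lean`
(`siteLaplacian_of_const/_of_affine/_of_quadratic`, `siteLaplacian_finset_sum`); nothing is cited
as a fact.  Printed counterparts, NAMED ONLY: M. Lüscher, Commun. Math. Phys. 293 (2010) 899, §4.3
eqs. (4.12)–(4.15) (the order-`t¹` equation `−ΔS̃⁽¹⁾ = −∂S·∂S̃⁽⁰⁾ + Ċ⁽¹⁾`, whose right-hand side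
for the CP(N−1)/O(N) action is `−(2κ²/(d−1)) Σ_n ‖p_n‖²` by `SphereLOFlowAction.siteGrad_esAction`
/ `loGenerator_eq`); Engel–Schaefer, Comput. Phys. Commun. 182 (2011) 2107, §3.

## Content (`E` finite-dimensional, `d = dim E`; configurations on the product of unit spheres)

With `J_n = Σ_m U_{nm} x_m` one has `‖p_n‖² = ‖J_n‖² − ⟪J_n, x_n⟫²`, and expanding the squares,
`Σ_n ‖p_n‖² = D + A − B − C` with (file `SphereNLOFlowAction.lean`)
* `stapleTerm U n m m' x = ⟪U_{nm} x_m, U_{nm'} x_{m'}⟫` (`m ≠ m'`, else `0`) — summing to `A`;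
* `crossTerm U n m m' x = ⟪U_{nm} x_m, x_n⟫⟪U_{nm'} x_{m'}, x_n⟫` (`m ≠ m'`, else `0`) — `B`;
* `squareTerm U n m x = ⟪U_{nm} x_m, x_n⟫²` — `C`; and `D = Σ ‖U_{nm} x_m‖²`.
This file computes THE LATTICE LAPLACE–BELTRAMI OPERATOR `Σ_k ∂̃_k·∂̃_k` ON EACH TERM (no
self-coupling, adjoint pairs, `‖x_k‖ = 1`):
* **`sum_siteLaplacian_stapleTerm`**: `Σ_k ∂̃²_k a = −2(d−1) a` (bilinear in two distinct sites:
  twice the linear eigenvalue);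
* **`sum_siteLaplacian_crossTerm`**: `Σ_k ∂̃²_k b = 2⟪U_{nm}x_m, U_{nm'}x_{m'}⟫ − (4d−2) b`
  (quadratic in `x_n`: `2⟪a₁,a₂⟫ − 2d b`; linear in `x_m` and in `x_{m'}`: `−(d−1) b` each);
* **`sum_siteLaplacian_squareTerm`**: `Σ_k ∂̃²_k c = 2‖U_{nm}x_m‖² + 2‖U_{mn}x_n‖² − 4d c`
  (quadratic in `x_n` and in `x_m`).
The sections `y ↦ term(x_k ← y)` are computed first (`*_update_*`), each a constant, an affine or
a product of two affine functions of `y`, and every term is `C²` in each site variable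
(`contDiff_*Term_update`).

NOT CLAIMED: the assembled potential and Lüscher's order-`t¹` equation (next file); anything
quantitative.
-/

noncomputable section

namespace Summit.Ventures.LatticeQCDFlow.Exactness

open NormedSpace Filter
open scoped RealInnerProductSpace

variable {E : Type*} [NormedAddCommGroup E] [InnerProductSpace ℝ E]
variable {Λ : Type*} [Fintype Λ] [DecidableEq Λ]

/-! ## §1 The terms and their sections in one site variable -/

section Terms

/-- **Staple term** `⟪U_{nm} x_m, U_{nm'} x_{m'}⟫` for `m ≠ m'` (the off-diagonal part of `‖J_n‖²`;
for nearest-neighbour couplings a next-nearest-neighbour / "staple" bilinear), `0` for `m = m'`. -/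
def stapleTerm (U : Λ → Λ → (E →L[ℝ] E)) (n m m' : Λ) (x : Λ → E) : ℝ :=
  if m = m' then 0 else ⟪U n m (x m), U n m' (x m')⟫

/-- **Cross term** `⟪U_{nm} x_m, x_n⟫⟪U_{nm'} x_{m'}, x_n⟫` for `m ≠ m'` (the off-diagonal part of
`⟪J_n, x_n⟫²`), `0` for `m = m'`. -/
def crossTerm (U : Λ → Λ → (E →L[ℝ] E)) (n m m' : Λ) (x : Λ → E) : ℝ :=
  if m = m' then 0 else ⟪U n m (x m), x n⟫ * ⟪U n m' (x m'), x n⟫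

/-- **Square term** `⟪U_{nm} x_m, x_n⟫²` (the diagonal part of `⟪J_n, x_n⟫²`). -/
def squareTerm (U : Λ → Λ → (E →L[ℝ] E)) (n m : Λ) (x : Λ → E) : ℝ :=
  ⟪U n m (x m), x n⟫ * ⟪U n m (x m), x n⟫

variable (U : Λ → Λ → (E →L[ℝ] E))

/-- Each term is smooth on configuration space. -/
theorem contDiff_stapleTerm (n m m' : Λ) {k : WithTop ℕ∞} : ContDiff ℝ k (stapleTerm U n m m') := by
  unfold stapleTerm
  by_cases h : m = m'
  · simp only [h, if_true]; exact contDiff_const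
  · simp only [h, if_false]
    exact ((U n m).contDiff.comp (contDiff_apply ℝ E m)).inner ℝ
      ((U n m').contDiff.comp (contDiff_apply ℝ E m'))

/-- Each term is smooth on configuration space. -/
theorem contDiff_crossTerm (n m m' : Λ) {k : WithTop ℕ∞} : ContDiff ℝ k (crossTerm U n m m') := by
  unfold crossTerm
  by_cases h : m = m'
  · simp only [h, if_true]; exact contDiff_const
  · simp only [h, if_false]
    exact (((U n m).contDiff.comp (contDiff_apply ℝ E m)).inner ℝ (contDiff_apply ℝ E n)).mul
      (((U n m').contDiff.comp (contDiff_apply ℝ E m')).inner ℝ (contDiff_apply ℝ E n))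

omit [DecidableEq Λ] in
/-- Each term is smooth on configuration space. -/
theorem contDiff_squareTerm (n m : Λ) {k : WithTop ℕ∞} : ContDiff ℝ k (squareTerm U n m) := by
  unfold squareTerm
  exact (((U n m).contDiff.comp (contDiff_apply ℝ E m)).inner ℝ (contDiff_apply ℝ E n)).mul
    (((U n m).contDiff.comp (contDiff_apply ℝ E m)).inner ℝ (contDiff_apply ℝ E n))

/-- Smoothness of a term in one site variable. -/
theorem contDiff_comp_update {F : (Λ → E) → ℝ} {k : WithTop ℕ∞} (hF : ContDiff ℝ k F) (x : Λ → E)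
    (i : Λ) : ContDiff ℝ k (fun y => F (Function.update x i y)) :=
  hF.comp (contDiff_update k x i)

variable {U}

/-! ### Sections of the staple term -/

omit [Fintype Λ] in
/-- Staple term, site `m` replaced (`m ≠ m'`): linear, `⟪U_{mn} U_{nm'} x_{m'}, y⟫`. -/
theorem stapleTerm_update_left (hUadj : ∀ m n (v w : E), ⟪U m n v, w⟫ = ⟪v, U n m w⟫)
    {n m m' : Λ} (hmm' : m ≠ m') (x : Λ → E) (y : E) :
    stapleTerm U n m m' (Function.update x m y) = ⟪U m n (U n m' (x m')), y⟫ + 0 := by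
  simp only [stapleTerm, hmm', if_false, Function.update_self, Function.update_of_ne hmm'.symm,
    add_zero]
  rw [hUadj, real_inner_comm]

omit [Fintype Λ] in
/-- Staple term, site `m'` replaced (`m ≠ m'`): linear, `⟪U_{m'n} U_{nm} x_m, y⟫`. -/
theorem stapleTerm_update_right (hUadj : ∀ m n (v w : E), ⟪U m n v, w⟫ = ⟪v, U n m w⟫)
    {n m m' : Λ} (hmm' : m ≠ m') (x : Λ → E) (y : E) :
    stapleTerm U n m m' (Function.update x m' y) = ⟪U m' n (U n m (x m)), y⟫ + 0 := by
  simp only [stapleTerm, hmm', if_false, Function.update_self, Function.update_of_ne hmm', add_zero]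
  rw [real_inner_comm, hUadj, real_inner_comm]

omit [Fintype Λ] in
/-- Staple term, another site replaced: unchanged. -/
theorem stapleTerm_update_other {n m m' k : Λ} (hkm : k ≠ m) (hkm' : k ≠ m') (x : Λ → E) (y : E) :
    stapleTerm U n m m' (Function.update x k y) = stapleTerm U n m m' x := by
  simp only [stapleTerm, Function.update_of_ne hkm.symm, Function.update_of_ne hkm'.symm]

/-! ### Sections of the cross term (`m, m' ≠ n`; the cases `m = n` or `m' = n` vanish identically) -/

omit [Fintype Λ] in
/-- With no self-coupling, the coupling `U_{nm}` applied to site `m` of a configuration does not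
see a replacement at site `n`. -/
theorem apply_update_self_site (hU0 : ∀ n, U n n = 0) (n m : Λ) (x : Λ → E) (y : E) :
    U n m (Function.update x n y m) = U n m (x m) := by
  by_cases h : m = n
  · subst h; simp [hU0]
  · rw [Function.update_of_ne h]

omit [Fintype Λ] in
/-- Cross term, site `n` replaced: a product of two linear functions of `y`. -/
theorem crossTerm_update_self (hU0 : ∀ n, U n n = 0) {n m m' : Λ} (hmm' : m ≠ m') (x : Λ → E)
    (y : E) :
    crossTerm U n m m' (Function.update x n y) = ⟪U n m (x m), y⟫ * ⟪U n m' (x m'), y⟫ := by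
  simp only [crossTerm, hmm', if_false, apply_update_self_site hU0, Function.update_self]

omit [Fintype Λ] in
/-- Cross term, site `m` replaced (`m ≠ n`, `m ≠ m'`): affine in `y`. -/
theorem crossTerm_update_left (hUadj : ∀ m n (v w : E), ⟪U m n v, w⟫ = ⟪v, U n m w⟫)
    {n m m' : Λ} (hmm' : m ≠ m') (hmn : m ≠ n) (x : Λ → E) (y : E) :
    crossTerm U n m m' (Function.update x m y) =
      ⟪⟪U n m' (x m'), x n⟫ • U m n (x n), y⟫ + 0 := by
  simp only [crossTerm, hmm', if_false, Function.update_self, Function.update_of_ne hmm'.symm,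
    Function.update_of_ne hmn.symm, add_zero, real_inner_smul_left]
  rw [hUadj n m y (x n), real_inner_comm (U m n (x n)) y]
  ring

omit [Fintype Λ] in
/-- Cross term, site `m'` replaced (`m' ≠ n`, `m ≠ m'`): affine in `y`. -/
theorem crossTerm_update_right (hUadj : ∀ m n (v w : E), ⟪U m n v, w⟫ = ⟪v, U n m w⟫)
    {n m m' : Λ} (hmm' : m ≠ m') (hm'n : m' ≠ n) (x : Λ → E) (y : E) :
    crossTerm U n m m' (Function.update x m' y) =
      ⟪⟪U n m (x m), x n⟫ • U m' n (x n), y⟫ + 0 := by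
  simp only [crossTerm, hmm', if_false, Function.update_self, Function.update_of_ne hmm',
    Function.update_of_ne hm'n.symm, add_zero, real_inner_smul_left]
  rw [hUadj n m' y (x n), real_inner_comm (U m' n (x n)) y]

omit [Fintype Λ] in
/-- Cross term, another site replaced: unchanged. -/
theorem crossTerm_update_other {n m m' k : Λ} (hkn : k ≠ n) (hkm : k ≠ m) (hkm' : k ≠ m')
    (x : Λ → E) (y : E) :
    crossTerm U n m m' (Function.update x k y) = crossTerm U n m m' x := by
  simp only [crossTerm, Function.update_of_ne hkn.symm, Function.update_of_ne hkm.symm,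
    Function.update_of_ne hkm'.symm]

omit [Fintype Λ] in
/-- The cross term vanishes identically when `m = n` (no self-coupling). -/
theorem crossTerm_eq_zero_left (hU0 : ∀ n, U n n = 0) (n m' : Λ) (x : Λ → E) :
    crossTerm U n n m' x = 0 := by
  unfold crossTerm
  split_ifs
  · rfl
  · simp [hU0]

omit [Fintype Λ] in
/-- The cross term vanishes identically when `m' = n` (no self-coupling). -/
theorem crossTerm_eq_zero_right (hU0 : ∀ n, U n n = 0) (n m : Λ) (x : Λ → E) :
    crossTerm U n m n x = 0 := by
  unfold crossTerm
  split_ifs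
  · rfl
  · simp [hU0]

/-! ### Sections of the square term (`m ≠ n`; the case `m = n` vanishes identically) -/

omit [Fintype Λ] in
/-- Square term, site `n` replaced: `⟪a, y⟫²`, `a = U_{nm} x_m`. -/
theorem squareTerm_update_self (hU0 : ∀ n, U n n = 0) (n m : Λ) (x : Λ → E) (y : E) :
    squareTerm U n m (Function.update x n y) = ⟪U n m (x m), y⟫ * ⟪U n m (x m), y⟫ := by
  simp only [squareTerm, apply_update_self_site hU0, Function.update_self]

omit [Fintype Λ] in
/-- Square term, site `m` replaced (`m ≠ n`): `⟪w, y⟫²`, `w = U_{mn} x_n`. -/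
theorem squareTerm_update_other_site (hUadj : ∀ m n (v w : E), ⟪U m n v, w⟫ = ⟪v, U n m w⟫)
    {n m : Λ} (hmn : m ≠ n) (x : Λ → E) (y : E) :
    squareTerm U n m (Function.update x m y) = ⟪U m n (x n), y⟫ * ⟪U m n (x n), y⟫ := by
  simp only [squareTerm, Function.update_self, Function.update_of_ne hmn.symm]
  rw [hUadj n m y (x n), real_inner_comm (U m n (x n)) y]

omit [Fintype Λ] in
/-- Square term, a third site replaced: unchanged. -/
theorem squareTerm_update_other {n m k : Λ} (hkn : k ≠ n) (hkm : k ≠ m) (x : Λ → E) (y : E) :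
    squareTerm U n m (Function.update x k y) = squareTerm U n m x := by
  simp only [squareTerm, Function.update_of_ne hkn.symm, Function.update_of_ne hkm.symm]

omit [Fintype Λ] [DecidableEq Λ] in
/-- The square term vanishes identically when `m = n`. -/
theorem squareTerm_eq_zero_self (hU0 : ∀ n, U n n = 0) (n : Λ) (x : Λ → E) :
    squareTerm U n n x = 0 := by
  simp [squareTerm, hU0]

end Terms

/-! ## §2 The lattice Laplace–Beltrami operator on each term -/

section Laplacians

variable [FiniteDimensional ℝ E] {U : Λ → Λ → (E →L[ℝ] E)}

/-- A sum over all sites with at most two exceptional sites. -/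
theorem sum_eq_of_two {f : Λ → ℝ} {m m' : Λ} (hmm' : m ≠ m') {a b : ℝ} (hm : f m = a)
    (hm' : f m' = b) (h : ∀ k, k ≠ m → k ≠ m' → f k = 0) : ∑ k, f k = a + b := by
  rw [← Finset.add_sum_erase _ _ (Finset.mem_univ m),
    ← Finset.add_sum_erase _ _ (Finset.mem_erase.2 ⟨hmm'.symm, Finset.mem_univ m'⟩), hm, hm',
    Finset.sum_eq_zero, add_zero]
  intro k hk
  rw [Finset.mem_erase, Finset.mem_erase] at hk
  exact h k hk.2.1 hk.1

/-- A sum over all sites with at most three exceptional sites. -/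
theorem sum_eq_of_three {f : Λ → ℝ} {n m m' : Λ} (hmn : m ≠ n) (hm'n : m' ≠ n) (hmm' : m ≠ m')
    {a b c : ℝ} (hn : f n = a) (hm : f m = b) (hm' : f m' = c)
    (h : ∀ k, k ≠ n → k ≠ m → k ≠ m' → f k = 0) : ∑ k, f k = a + b + c := by
  rw [← Finset.add_sum_erase _ _ (Finset.mem_univ n),
    ← Finset.add_sum_erase _ _ (Finset.mem_erase.2 ⟨hmn, Finset.mem_univ m⟩),
    ← Finset.add_sum_erase _ _
      (Finset.mem_erase.2 ⟨hmm'.symm, Finset.mem_erase.2 ⟨hm'n, Finset.mem_univ m'⟩⟩),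
    hn, hm, hm', Finset.sum_eq_zero, add_zero, add_assoc]
  intro k hk
  rw [Finset.mem_erase, Finset.mem_erase, Finset.mem_erase] at hk
  exact h k hk.2.2.1 hk.2.1 hk.1

/-- **The staple term is an eigenfunction: `Σ_k ∂̃_k·∂̃_k a = −2(d−1) a`.** -/
theorem sum_siteLaplacian_stapleTerm (hUadj : ∀ m n (v w : E), ⟪U m n v, w⟫ = ⟪v, U n m w⟫)
    (n m m' : Λ) {x : Λ → E} (hx : ∀ k, ‖x k‖ = 1) :
    ∑ k, siteLaplacian k (stapleTerm U n m m') x =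
      -(2 * ((Module.finrank ℝ E : ℝ) - 1)) * stapleTerm U n m m' x := by
  by_cases hmm' : m = m'
  · -- the term vanishes identically
    have h0 : ∀ x', stapleTerm U n m m' x' = 0 := fun x' => by simp [stapleTerm, hmm']
    rw [h0, mul_zero]
    exact Finset.sum_eq_zero fun k _ => siteLaplacian_of_const (c := 0) fun y => h0 _
  · have hval : stapleTerm U n m m' x = ⟪U m n (U n m' (x m')), x m⟫ := by
      have h := stapleTerm_update_left (n := n) hUadj hmm' x (x m)
      rwa [Function.update_eq_self, add_zero] at h
    have hval' : stapleTerm U n m m' x = ⟪U m' n (U n m (x m)), x m'⟫ := by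
      have h := stapleTerm_update_right (n := n) hUadj hmm' x (x m')
      rwa [Function.update_eq_self, add_zero] at h
    refine sum_eq_of_two hmm' (a := -(((Module.finrank ℝ E : ℝ) - 1) * stapleTerm U n m m' x))
      (b := -(((Module.finrank ℝ E : ℝ) - 1) * stapleTerm U n m m' x)) ?_ ?_ ?_ |>.trans (by ring)
    · rw [hval]
      exact siteLaplacian_of_affine (hx m) (stapleTerm_update_left (n := n) hUadj hmm' x)
    · rw [hval']
      exact siteLaplacian_of_affine (hx m') (stapleTerm_update_right (n := n) hUadj hmm' x)
    · intro k hkm hkm'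
      exact siteLaplacian_of_const (c := stapleTerm U n m m' x)
        fun y => stapleTerm_update_other hkm hkm' x y

/-- **The cross term: `Σ_k ∂̃_k·∂̃_k b = 2a − (4d−2) b`** with `a = ⟪U_{nm} x_m, U_{nm'} x_{m'}⟫`
the staple term (both sides vanish when `m = m'`, or when `m` or `m'` is `n`). -/
theorem sum_siteLaplacian_crossTerm (hU0 : ∀ n, U n n = 0)
    (hUadj : ∀ m n (v w : E), ⟪U m n v, w⟫ = ⟪v, U n m w⟫) (n m m' : Λ)
    {x : Λ → E} (hx : ∀ k, ‖x k‖ = 1) :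
    ∑ k, siteLaplacian k (crossTerm U n m m') x =
      2 * stapleTerm U n m m' x -
        (4 * (Module.finrank ℝ E : ℝ) - 2) * crossTerm U n m m' x := by
  by_cases hmm' : m = m'
  · have h0 : ∀ x', crossTerm U n m m' x' = 0 := fun x' => by simp [crossTerm, hmm']
    have hL : ∑ k, siteLaplacian k (crossTerm U n m m') x = 0 :=
      Finset.sum_eq_zero fun k _ => siteLaplacian_of_const (c := 0) fun y => h0 _
    rw [hL, h0]
    simp [stapleTerm, hmm']
  have hst : stapleTerm U n m m' x = ⟪U n m (x m), U n m' (x m')⟫ := by simp [stapleTerm, hmm']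
  rw [hst]
  by_cases hmn : m = n
  · subst hmn
    have h0 : ∀ x', crossTerm U m m m' x' = 0 := crossTerm_eq_zero_left hU0 m m'
    rw [h0, hU0]
    simp only [zero_apply, inner_zero_left, mul_zero, sub_zero]
    exact Finset.sum_eq_zero fun k _ => siteLaplacian_of_const (c := 0) fun y => h0 _
  by_cases hm'n : m' = n
  · subst hm'n
    have h0 : ∀ x', crossTerm U m' m m' x' = 0 := crossTerm_eq_zero_right hU0 m' m
    rw [h0, hU0]
    simp only [zero_apply, inner_zero_right, mul_zero, sub_zero]
    exact Finset.sum_eq_zero fun k _ => siteLaplacian_of_const (c := 0) fun y => h0 _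
  -- generic case: `n, m, m'` pairwise distinct
  have hval : crossTerm U n m m' x = ⟪U n m (x m), x n⟫ * ⟪U n m' (x m'), x n⟫ := by
    simp [crossTerm, hmm']
  have hn : siteLaplacian n (crossTerm U n m m') x =
      2 * ⟪U n m (x m), U n m' (x m')⟫ -
        2 * (Module.finrank ℝ E : ℝ) * crossTerm U n m m' x := by
    rw [hval]; exact siteLaplacian_of_quadratic (hx n) (crossTerm_update_self hU0 hmm' x)
  have hm : siteLaplacian m (crossTerm U n m m') x =
      -(((Module.finrank ℝ E : ℝ) - 1) * crossTerm U n m m' x) := by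
    have h := siteLaplacian_of_affine (hx m) (crossTerm_update_left hUadj hmm' hmn x)
    rw [h, hval, real_inner_smul_left, hUadj m n (x n) (x m), real_inner_comm (U n m (x m)) (x n)]
    ring
  have hm' : siteLaplacian m' (crossTerm U n m m') x =
      -(((Module.finrank ℝ E : ℝ) - 1) * crossTerm U n m m' x) := by
    have h := siteLaplacian_of_affine (hx m') (crossTerm_update_right hUadj hmm' hm'n x)
    rw [h, hval, real_inner_smul_left, hUadj m' n (x n) (x m'),
      real_inner_comm (U n m' (x m')) (x n)]
  rw [sum_eq_of_three hmn hm'n hmm' hn hm hm' fun k hkn hkm hkm' =>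
    siteLaplacian_of_const (c := crossTerm U n m m' x) fun y => crossTerm_update_other hkn hkm hkm' x y]
  ring

/-- **The square term: `Σ_k ∂̃_k·∂̃_k c = 2‖U_{nm} x_m‖² + 2‖U_{mn} x_n‖² − 4d c`** (both sides
vanish when `m = n`). -/
theorem sum_siteLaplacian_squareTerm (hU0 : ∀ n, U n n = 0)
    (hUadj : ∀ m n (v w : E), ⟪U m n v, w⟫ = ⟪v, U n m w⟫) (n m : Λ) {x : Λ → E}
    (hx : ∀ k, ‖x k‖ = 1) :
    ∑ k, siteLaplacian k (squareTerm U n m) x =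
      2 * ‖U n m (x m)‖ ^ 2 + 2 * ‖U m n (x n)‖ ^ 2 -
        4 * (Module.finrank ℝ E : ℝ) * squareTerm U n m x := by
  by_cases hmn : m = n
  · subst hmn
    have h0 : ∀ x', squareTerm U m m x' = 0 := squareTerm_eq_zero_self hU0 m
    have hL : ∑ k, siteLaplacian k (squareTerm U m m) x = 0 :=
      Finset.sum_eq_zero fun k _ => siteLaplacian_of_const (c := 0) fun y => h0 _
    rw [hL, h0, hU0]
    simp
  have hval : squareTerm U n m x = ⟪U n m (x m), x n⟫ * ⟪U n m (x m), x n⟫ := rfl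
  have hval' : squareTerm U n m x = ⟪U m n (x n), x m⟫ * ⟪U m n (x n), x m⟫ := by
    have h := squareTerm_update_other_site hUadj hmn x (x m)
    rwa [Function.update_eq_self] at h
  have hn : siteLaplacian n (squareTerm U n m) x =
      2 * ‖U n m (x m)‖ ^ 2 - 2 * (Module.finrank ℝ E : ℝ) * squareTerm U n m x := by
    rw [hval, ← real_inner_self_eq_norm_sq]
    exact siteLaplacian_of_quadratic (hx n) (squareTerm_update_self hU0 n m x)
  have hm : siteLaplacian m (squareTerm U n m) x =
      2 * ‖U m n (x n)‖ ^ 2 - 2 * (Module.finrank ℝ E : ℝ) * squareTerm U n m x := by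
    rw [hval', ← real_inner_self_eq_norm_sq]
    exact siteLaplacian_of_quadratic (hx m) (squareTerm_update_other_site hUadj hmn x)
  rw [sum_eq_of_two (Ne.symm hmn) hn hm fun k hkn hkm =>
    siteLaplacian_of_const (c := squareTerm U n m x) fun y => squareTerm_update_other hkn hkm x y]
  ring

end Laplacians

end Summit.Ventures.LatticeQCDFlow.Exactness

end
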